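import Mathlib.LinearAlgebra.Matrix.Transvection
import Mathlib.GroupTheory.Perm.Sign
import Mathlib.Order.PiLex
import Mathlib.Data.List.GetD
import Mathlib.Algebra.BigOperators.Pi
import Mathlib.LinearAlgebra.Dimension.Finite
import Literature.NumberTheory.DiophantineGeometry.TensorWordModel
import Literature.NumberTheory.DiophantineGeometry.StandardFillings
import HarnessLib

/-!
# Schur–Weyl duality, multiplicity form: proof of `hwMultiplicity_glTensorRep`
(trunk ArithGeomL / CplxAlg; discharges the named fact `hwMultiplicity_glTensorRep` of
`SchurWeylPlethysm`)

**Theorem** (`hwMultiplicity_glTensorRep_holds`). Let `k` be a field of characteristic zero,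
`N ∈ ℕ`, and `μ ⊢ d` a partition with at most `N` parts. Then the space of highest-weight
vectors (upper triangular Borel) of weight `μ = (μ_1, …, μ_N)` in the tensor power `(k^N)^{⊗d}`
has dimension `f^μ`, the number of standard Young tableaux of shape `μ`:
`hwMultiplicity (glTensorRep (Fin N) k d) (Weight.ofPartition N μ) = numStandardTableaux μ`.

This is the multiplicity form of Schur–Weyl duality, `E^{⊗n} ≅ ⊕_λ (E^λ)^{⊕ f^λ}` with each
`E^λ` irreducible with a unique highest-weight line, of weight `λ` — Fulton, *Young Tableaux*,
§8.3 Corollary 1 (p. 119) together with §8.2 Lemma 4 and Theorem 2 (pp. 112–114); Fulton–Harris,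
Thm 6.3 (2) and Cor. 6.6. Fulton's printed proof goes through the representation theory of
`S_n` (Specht modules, `ℂ[S_n] ≅ ⊕ End(S^λ)`, the RSK count `∑ (f^λ)² = n!`, Ch. 7). The proof
formalised here is elementary and self-contained; it works in the coordinate ("words") model
`wordRep k N m` of `(k^N)^{⊗m}` (file `TensorWordModel`) and proves the two inequalities
separately for every Young diagram `Y` with at most `N` rows (`λ = ydWeight N Y`):

* **Upper bound** `dim HW_λ((k^N)^{⊗|λ|}) ≤ f^λ` (`finrank_highestWeightSpace_le_card_stdFilling`),
  by induction on `|λ|` from the *Pieri inequality*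
  `dim HW_λ(E^{⊗(m+1)}) ≤ ∑_r dim HW_{λ-ε_r}(E^{⊗m})` (`finrank_highestWeightSpace_succ_le`, file
  `TensorWordModel`) and the branching rule `f^λ = ∑_{corners} f^{λ⁻}`
  (`StdFilling.card_stdFilling_succ`, file `StandardFillings`). The summands with `λ - ε_r` not
  a partition vanish: a negative entry is impossible for a weight of `E^{⊗m}`
  (`highestWeightSpace_wordRep_eq_bot_of_neg`), and **a highest weight is dominant**
  (`highestWeightSpace_wordRep_eq_bot_of_lt`), proved here by the `𝔰𝔩_2`-ladder: a
  highest-weight vector is killed by the raising operators `E_{r s}`, `r < s`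
  (`wordRaise_eq_zero_of_mem_highestWeightSpace` — invariance under the transvection
  `1 + E_{r s}` read on one content layer, Fulton §8.2, proof of Lemma 4), `[E_{r s}, E_{s r}]`
  acts on a content layer by `n_r - n_s` (`wordRaise_comm_apply`), and the ladder
  `E F^{j+1} c = (j+1)(λ-j) F^j c` with `λ < 0` forces `c = 0` (Fulton–Harris §11.1, (11.5)).
* **Lower bound** `f^λ ≤ dim HW_λ` (`StdFilling.card_stdFilling_le_finrank`): the polytabloids
  `e_T = ∑_{σ ∈ C_T} sgn(σ) e_{w_T ∘ σ⁻¹}` (`StdFilling.polytabloid`; Fulton's `v_T`, James'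
  `κ_t{t}`) of the standard tableaux `T` are highest-weight vectors of weight `λ`
  (`StdFilling.polytabloid_mem`: for upper triangular `g`, `g e_{w_T} = χ_λ(g) e_{w_T} +` terms
  `e_{w'}` with `w' < w_T` letterwise, which the column antisymmetriser kills by a pigeonhole in
  the columns — Fulton §8.2, proof of Lemma 4, with §8.1 Lemma 1 (i) and §7.2 Lemma 2) and are
  linearly independent
  (`StdFilling.linearIndependent_polytabloid`: `w_T` is the colexicographically last word in the
  support of `e_T` — James 8.2–8.3, Fulton §7.2, proof of Prop. 2 — and a standard tableau is
  determined by its row word).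

## Sources

* W. Fulton, *Young Tableaux*, LMS Student Texts 35 (1997), §4.3 (8) (branching of `f^λ`),
  §7.1–7.2 (`C(T)`, `b_T`, `v_T`, Lemma 2, Prop. 2), §8.1 (Lemma 1, Thm 1), §8.2 (Exercise 3,
  Lemma 4 and its proof, Thm 2; pp. 111–114), §8.3 (Cor. 1, p. 119).
  [cite: FultonYoungTableaux1997, §8.3 Cor. 1 with §8.2 Lemma 4]
* W. Fulton, J. Harris, *Representation Theory*, GTM 129 (1991), §6.1 (Thm 6.3 (2):
  `V^{⊗d} ≅ ⊕ S_λV^{⊕ m_λ}`; Cor. 6.6; Pieri (6.8); Ex. 6.12), §6.2 (Lemma 6.22), §11.1 (the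
  `𝔰𝔩_2` ladder: (11.1), Claim 11.4, (11.5)), §14.1 (highest weight vectors, Prop. 14.13),
  Prop. 15.15, §15.5. [cite: FultonHarrisGTM129, Thm 6.3 (2)]
* G. D. James, *The Representation Theory of the Symmetric Groups*, LNM 682 (1978), 3.8–3.10
  (`R_t`, `C_t`, tabloids), 4.3 (`κ_t`, polytabloids `e_t = {t}κ_t`), 4.6 (and its proof: two
  entries in one row of `t*` and one column of `t` give `{t*}κ_t = 0`), 8.1–8.5 (standard
  polytabloids are linearly independent, `{t}` being the last tabloid involved in `e_t`).
  [cite: JamesLNM682, 8.2–8.4]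

## Mathlib

Used: `Matrix.transvection` (`det_transvection_of_ne`), `Matrix.GeneralLinearGroup.mkOfDetNeZero`,
`Function.update`, `Finset.sum_bij_ne_zero`/`sum_bij'`/`card_bij`, `Equiv.Perm.sign`
(`sign_mul`, `sign_swap`), `Equiv.swap`, `Pi.toColex` with the linear order on
`Colex (Fin d → Fin N)` (`Mathlib.Order.PiLex`), `pi_eq_sum_univ'`, `linearIndependent_iff'`,
`LinearIndependent.fintype_card_le_finrank`, `YoungDiagram` (`row`, `rowLen_eq_card`,
`up_left_mem`). Mathlib has no raising/lowering operators on tensor powers, no polytabloids or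
Specht modules, and no Schur–Weyl duality.

## Design

* Everything is in `namespace Literature.CplxAlg`, in the coordinate model `Word N m → k` of
  `TensorWordModel`; the transfer to `glTensorRep` is `hwMultiplicity_glTensorRep_eq_wordRep`.
* `wordRaise k r s` is defined for any `r s : Fin N` (raising for `r < s`, lowering for `r > s`),
  over a commutative ring; the vanishing statements need a field of characteristic zero (they
  are false in positive characteristic). The ladder bookkeeping uses the auxiliary predicate
  `IsRSSupported a b x y c` ("`c` lives on words with `x` letters `a` and `y` letters `b`",
  `x y : ℤ` so that no side conditions are needed along the ladder).
* `ydWeight N Y i = Y.rowLen i` ignores rows `≥ N`; all theorems carry the hypothesis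
  `∀ x ∈ Y.cells, x.1 < N` (for `μ.youngDiagram` it is `μ.parts.card ≤ N`,
  `fst_lt_of_mem_youngDiagram`), and the polytabloid constructions take it as the explicit
  argument `hN` (it is needed to read rows as letters in `Fin N`).
* The column stabiliser `StdFilling.colStab` is a `Finset` of permutations (closure under `1`,
  `*`, `⁻¹`, transpositions is recorded), which keeps the sums `∑_{σ ∈ C_T}` elementary.
-/

noncomputable section

open scoped BigOperators

namespace Literature.NumberTheory.DiophantineGeometry

/-! ### Raising and lowering operators on the coordinate model -/

section Raise

variable (k : Type*) [CommRing k] {N m : ℕ}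

/-- The operator `E_{r s}` on the coordinate model `(k^N)^{⊗m}` replacing one letter `r` by the
letter `s`, summed over the positions carrying `r`:
`(E_{r s} c)(w) = ∑_{p : w p = r} c (w[p ↦ s])`. For `r < s` this is (the transpose of) the
action of the elementary matrix `E_{s r} ∈ 𝔤𝔩_N` on `E^{⊗m}`, i.e. a *raising operator*; for
`r > s` a lowering operator. Fulton, *Young Tableaux*, §8.2 (proof of Lemma 4: the derivative of
the action of `1 + t E_{i j}`); Fulton–Harris §15.5. [folklore] -/
def wordRaise (r s : Fin N) : (Word N m → k) →ₗ[k] (Word N m → k) where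
  toFun c w := ∑ p ∈ Finset.univ.filter (fun p => w p = r), c (Function.update w p s)
  map_add' a b := by
    funext w
    simp only [Pi.add_apply, Finset.sum_add_distrib]
  map_smul' a c := by
    funext w
    simp only [Pi.smul_apply, smul_eq_mul, Finset.mul_sum, RingHom.id_apply]

/-- Unfolding lemma for `wordRaise`. [folklore] -/
theorem wordRaise_apply (r s : Fin N) (c : Word N m → k) (w : Word N m) :
    wordRaise k r s c w =
      ∑ p ∈ Finset.univ.filter (fun p => w p = r), c (Function.update w p s) :=
  rfl

variable {k}

/-- Replacing a letter `a` at position `p` by `b ≠ a` removes one occurrence of `a`.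
[folklore] -/
theorem wordContent_update_self {w : Word N m} {p : Fin m} {a b : Fin N} (hp : w p = a)
    (hab : a ≠ b) : wordContent (Function.update w p b) a + 1 = wordContent w a := by
  classical
  unfold wordContent
  have h : Finset.univ.filter (fun q => Function.update w p b q = a) =
      (Finset.univ.filter fun q => w q = a).erase p := by
    ext q
    by_cases hq : q = p
    · subst hq
      simp [hab.symm]
    · simp [hq]
  rw [h, Finset.card_erase_of_mem (by simp [hp])]
  have : 0 < (Finset.univ.filter fun q => w q = a).card :=
    Finset.card_pos.2 ⟨p, by simp [hp]⟩
  omega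

/-- Replacing a letter `a` at position `p` by `b ≠ a` adds one occurrence of `b`. [folklore] -/
theorem wordContent_update_new {w : Word N m} {p : Fin m} {a b : Fin N} (hp : w p = a)
    (hab : a ≠ b) : wordContent (Function.update w p b) b = wordContent w b + 1 := by
  classical
  unfold wordContent
  have h : Finset.univ.filter (fun q => Function.update w p b q = b) =
      insert p (Finset.univ.filter fun q => w q = b) := by
    ext q
    by_cases hq : q = p
    · subst hq
      simp
    · simp [hq]
  rw [h, Finset.card_insert_of_notMem (by simp [hp, hab])]

/-- Replacing a letter `a` by `b` does not change the number of occurrences of a third letter.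
[folklore] -/
theorem wordContent_update_of_ne {w : Word N m} {p : Fin m} {a b i : Fin N} (hp : w p = a)
    (hia : i ≠ a) (hib : i ≠ b) : wordContent (Function.update w p b) i = wordContent w i := by
  classical
  unfold wordContent
  congr 1
  ext q
  by_cases hq : q = p
  · subst hq
    simp [hp, hia.symm, hib.symm]
  · simp [Function.update_of_ne hq]

/-- The composite `E_{a b} E_{b a}` on the coordinate model:
`(E_{a b} E_{b a} c)(w) = n_a(w) c(w) + ∑_{p : w p = a} ∑_{q : w q = b} c(w[q ↦ a][p ↦ b])`
(the diagonal term comes from undoing the replacement just made). Fulton–Harris §11.1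
(the computation `[X, Y] = H` on `Sym`/tensor powers). [folklore] -/
theorem wordRaise_wordRaise_apply {a b : Fin N} (hab : a ≠ b) (c : Word N m → k)
    (w : Word N m) :
    wordRaise k a b (wordRaise k b a c) w =
      (wordContent w a : k) * c w +
        ∑ p ∈ Finset.univ.filter (fun p => w p = a),
          ∑ q ∈ Finset.univ.filter (fun q => w q = b),
            c (Function.update (Function.update w q a) p b) := by
  classical
  rw [wordRaise_apply]
  have key : ∀ p ∈ Finset.univ.filter (fun p => w p = a),
      wordRaise k b a c (Function.update w p b) =
        c w + ∑ q ∈ Finset.univ.filter (fun q => w q = b),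
          c (Function.update (Function.update w q a) p b) := by
    intro p hp
    simp only [Finset.mem_filter, Finset.mem_univ, true_and] at hp
    rw [wordRaise_apply]
    have hset : Finset.univ.filter (fun q => Function.update w p b q = b) =
        insert p (Finset.univ.filter fun q => w q = b) := by
      ext q
      by_cases hq : q = p
      · subst hq
        simp
      · simp [hq]
    rw [hset, Finset.sum_insert (by simp [hp, hab])]
    congr 1
    · rw [Function.update_idem, ← hp, Function.update_eq_self]
    · refine Finset.sum_congr rfl fun q hq => ?_
      simp only [Finset.mem_filter, Finset.mem_univ, true_and] at hq
      have hpq : p ≠ q := by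
        rintro rfl
        exact hab (hp.symm.trans hq)
      rw [Function.update_comm hpq]
  rw [Finset.sum_congr rfl key, Finset.sum_add_distrib, Finset.sum_const, nsmul_eq_mul]
  rfl

/-- **The commutator of raising and lowering is the weight difference**:
`(E_{a b} E_{b a} - E_{b a} E_{a b}) c (w) = (n_a(w) - n_b(w)) c(w)`, i.e. `[E, F] = H` for the
`𝔰𝔩_2 ⊂ 𝔤𝔩_N` in rows/columns `a, b` acting on `E^{⊗m}`. Fulton–Harris §11.1, (11.1);
Fulton, *Young Tableaux*, §8.2. [folklore] -/
theorem wordRaise_comm_apply {a b : Fin N} (hab : a ≠ b) (c : Word N m → k) (w : Word N m) :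
    wordRaise k a b (wordRaise k b a c) w - wordRaise k b a (wordRaise k a b c) w =
      ((wordContent w a : k) - wordContent w b) * c w := by
  classical
  rw [wordRaise_wordRaise_apply hab, wordRaise_wordRaise_apply (Ne.symm hab)]
  have hS : ∑ p ∈ Finset.univ.filter (fun p => w p = b),
      ∑ q ∈ Finset.univ.filter (fun q => w q = a),
        c (Function.update (Function.update w q b) p a) =
      ∑ p ∈ Finset.univ.filter (fun p => w p = a),
        ∑ q ∈ Finset.univ.filter (fun q => w q = b),
          c (Function.update (Function.update w q a) p b) := by
    rw [Finset.sum_comm]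
    refine Finset.sum_congr rfl fun p hp => Finset.sum_congr rfl fun q hq => ?_
    simp only [Finset.mem_filter, Finset.mem_univ, true_and] at hp hq
    have hpq : p ≠ q := by
      rintro rfl
      exact hab (hp.symm.trans hq)
    rw [Function.update_comm hpq]
  rw [hS]
  ring

end Raise

/-! ### Transvections act through the raising operator; highest-weight vectors are killed -/

section Transvection

variable (k : Type*) [Field k] {N m : ℕ}

/-- The elementary unipotent matrix (transvection) `x_{r s} = 1 + E_{r s} ∈ GL_N(k)`, `r ≠ s`.
Fulton, *Young Tableaux*, §8.2 (proof of Lemma 4); Mathlib `Matrix.transvection`. [folklore] -/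
def transvecGL (r s : Fin N) (h : r ≠ s) : GL (Fin N) k :=
  Matrix.GeneralLinearGroup.mkOfDetNeZero (Matrix.transvection r s (1 : k))
    (by rw [Matrix.det_transvection_of_ne r s h]; exact one_ne_zero)

/-- Entries of the transvection: `(x_{r s})_{i j} = [i = j] + [i = r ∧ j = s]`. [folklore] -/
theorem transvecGL_apply (r s : Fin N) (h : r ≠ s) (i j : Fin N) :
    ((transvecGL k r s h : GL (Fin N) k) : Matrix (Fin N) (Fin N) k) i j =
      (if i = j then 1 else 0) + if r = i ∧ s = j then 1 else 0 := by
  simp [transvecGL, Matrix.GeneralLinearGroup.val_mkOfDetNeZero, Matrix.transvection,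
    Matrix.one_apply, Matrix.single_apply]

/-- The diagonal entries of a transvection are `1`. [folklore] -/
theorem transvecGL_apply_self (r s : Fin N) (h : r ≠ s) (i : Fin N) :
    ((transvecGL k r s h : GL (Fin N) k) : Matrix (Fin N) (Fin N) k) i i = 1 := by
  rw [transvecGL_apply, if_pos rfl, if_neg, add_zero]
  rintro ⟨rfl, rfl⟩
  exact h rfl

/-- The `(r, s)` entry of the transvection `x_{r s}` is `1`. [folklore] -/
theorem transvecGL_apply_rs (r s : Fin N) (h : r ≠ s) :
    ((transvecGL k r s h : GL (Fin N) k) : Matrix (Fin N) (Fin N) k) r s = 1 := by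
  rw [transvecGL_apply, if_neg h, if_pos ⟨rfl, rfl⟩, zero_add]

/-- The nonzero entries of `x_{r s}` are the diagonal ones and `(r, s)`. [folklore] -/
theorem transvecGL_apply_ne_zero {r s : Fin N} {h : r ≠ s} {i j : Fin N}
    (hij : ((transvecGL k r s h : GL (Fin N) k) : Matrix (Fin N) (Fin N) k) i j ≠ 0) :
    j = i ∨ (i = r ∧ j = s) := by
  rw [transvecGL_apply] at hij
  by_cases h1 : i = j
  · exact Or.inl h1.symm
  · rw [if_neg h1, zero_add] at hij
    by_cases h2 : r = i ∧ s = j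
    · exact Or.inr ⟨h2.1.symm, h2.2.symm⟩
    · exact absurd (if_neg h2) hij

/-- For `r < s` the transvection `x_{r s}` is upper triangular (lies in the Borel subgroup).
Fulton, *Young Tableaux*, §8.2. [folklore] -/
theorem isUpperTriangular_transvecGL {r s : Fin N} (h : r < s) :
    IsUpperTriangular (transvecGL k r s h.ne) := by
  intro i j hij
  change j < i at hij
  rw [transvecGL_apply, if_neg (ne_of_lt hij).symm, if_neg, add_zero]
  rintro ⟨rfl, rfl⟩
  exact lt_asymm h hij

/-- Transvections have trivial weight character (`x_{r s}` is unipotent). [folklore] -/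
theorem weightChar_transvecGL (χ : Weight (Fin N)) (r s : Fin N) (h : r ≠ s) :
    weightChar χ (transvecGL k r s h) = 1 := by
  unfold weightChar
  exact Finset.prod_eq_one fun i _ => by rw [transvecGL_apply_self, one_zpow]

variable {k}

/-- **The transvection acts through the raising operator on the next `r`-layer.** If `c` is
supported on words with one letter `r` fewer than `w'`, then
`(x_{r s} · c)(w') = (E_{r s} c)(w')`: expanding `∏_p (δ + E_{r s})_{w' p, w p}`, exactly the
words `w = w'[p ↦ s]` (`p` a position of an `r` in `w'`) contribute. This is the coefficient
extraction in Fulton, *Young Tableaux*, §8.2, proof of Lemma 4 (there via `d/dt` at `t = 0` of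
`1 + t E_{r s}`; here via the weight grading, so no derivative is needed). [folklore] -/
theorem wordRep_transvecGL_apply {r s : Fin N} (h : r ≠ s) {c : Word N m → k} {w' : Word N m}
    (hc : ∀ w, c w ≠ 0 → wordContent w r + 1 = wordContent w' r) :
    wordRep k N m (transvecGL k r s h) c w' = wordRaise k r s c w' := by
  classical
  rw [wordRep_apply, wordRaise_apply]
  symm
  refine Finset.sum_bij_ne_zero (fun p _ _ => Function.update w' p s)
    (fun _ _ _ => Finset.mem_univ _) ?_ ?_ ?_
  · -- injectivity
    intro p₁ h₁ _ p₂ h₂ _ heq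
    simp only [Finset.mem_filter, Finset.mem_univ, true_and] at h₁ h₂
    by_contra hne
    have := congrFun heq p₁
    rw [Function.update_self, Function.update_of_ne hne] at this
    exact h (h₁.symm.trans this.symm)
  · -- surjectivity onto the support
    intro w _ hw
    have hprod := left_ne_zero_of_mul hw
    have hcw := right_ne_zero_of_mul hw
    have hdisj : ∀ p, w p = w' p ∨ (w' p = r ∧ w p = s) := fun p =>
      transvecGL_apply_ne_zero k (Finset.prod_ne_zero_iff.1 hprod p (Finset.mem_univ p))
    set S := Finset.univ.filter (fun p => w p ≠ w' p) with hS_def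
    have hS : S ⊆ Finset.univ.filter (fun p => w' p = r) := by
      intro p hp
      simp only [hS_def, Finset.mem_filter, Finset.mem_univ, true_and] at hp ⊢
      rcases hdisj p with h' | h'
      · exact absurd h' hp
      · exact h'.1
    have hA : Finset.univ.filter (fun q => w q = r) =
        Finset.univ.filter (fun q => w' q = r) \ S := by
      ext q
      simp only [hS_def, Finset.mem_sdiff, Finset.mem_filter, Finset.mem_univ, true_and,
        not_not]
      constructor
      · intro hq
        rcases hdisj q with h' | h'
        · exact ⟨h' ▸ hq, h'⟩
        · exact absurd (h'.2.symm.trans hq) (Ne.symm h)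
      · rintro ⟨hq, hq'⟩
        exact hq'.trans hq
    have hcard : S.card = 1 := by
      have h₁ := hc w hcw
      unfold wordContent at h₁
      rw [hA, Finset.card_sdiff_of_subset hS] at h₁
      have h₂ := Finset.card_le_card hS
      omega
    obtain ⟨p₀, hp₀⟩ := Finset.card_eq_one.1 hcard
    have hp₀S : p₀ ∈ S := by rw [hp₀]; exact Finset.mem_singleton_self _
    have hw_eq : Function.update w' p₀ s = w := by
      funext q
      by_cases hq : q = p₀
      · subst hq
        rw [Function.update_self]
        have hq' : w q ≠ w' q := by simpa [hS_def] using hp₀S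
        rcases hdisj q with h' | h'
        · exact absurd h' hq'
        · exact h'.2.symm
      · rw [Function.update_of_ne hq]
        have hqS : q ∉ S := by rw [hp₀]; simpa using hq
        have : w q = w' q := by simpa [hS_def] using hqS
        exact this.symm
    refine ⟨p₀, hS hp₀S, ?_, hw_eq⟩
    rwa [hw_eq]
  · -- the coefficient of a contributing word is `1`
    intro p hp _
    simp only [Finset.mem_filter, Finset.mem_univ, true_and] at hp
    rw [Finset.prod_eq_one, one_mul]
    intro q _
    by_cases hq : q = p
    · subst hq
      rw [Function.update_self, hp, transvecGL_apply_rs]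
    · rw [Function.update_of_ne hq, transvecGL_apply_self]

/-- **Raising operators kill highest-weight vectors** (`r < s`, characteristic zero): a
highest-weight vector `c` of weight `ν` in `(k^N)^{⊗m}` satisfies `E_{r s} c = 0`. Indeed `c` is
fixed by the unipotent upper triangular `x_{r s}` and supported in content `ν`
(`apply_eq_zero_of_mem_highestWeightSpace`), and on the content layer `ν + ε_r - ε_s` the vector
`x_{r s} · c = c` restricts to `E_{r s} c` (`wordRep_transvecGL_apply`) and `c` to `0`.
Fulton, *Young Tableaux*, §8.2, proof of Lemma 4 (test a `B`-eigenvector against the elementary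
matrices `1 + E_{p q}`, `p < q`); Fulton–Harris §14.1 (Definition before Prop. 14.13: a highest
weight vector is killed by `𝔤_α`, `α ∈ R⁺`). [folklore] -/
theorem wordRaise_eq_zero_of_mem_highestWeightSpace [CharZero k] {r s : Fin N} (hrs : r < s)
    {ν : Weight (Fin N)} {c : Word N m → k}
    (hc : c ∈ highestWeightSpace (wordRep k N m) ν) : wordRaise k r s c = 0 := by
  classical
  have hsupp : ∀ w, c w ≠ 0 → (wordContent w r : ℤ) = ν r := fun w hw => by
    by_contra hne
    exact hw (apply_eq_zero_of_mem_highestWeightSpace k hc hne)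
  funext w'
  rw [Pi.zero_apply]
  by_cases hw' : (wordContent w' r : ℤ) = ν r + 1
  · -- on the layer `n_r = ν_r + 1` the transvection acts as `E_{r s}`, and `c` vanishes there
    have h1 : wordRep k N m (transvecGL k r s hrs.ne) c w' = wordRaise k r s c w' := by
      refine wordRep_transvecGL_apply hrs.ne fun w hw => ?_
      have := hsupp w hw
      omega
    have h2 := congrFun (hc _ (isUpperTriangular_transvecGL k hrs)) w'
    rw [weightChar_transvecGL, one_smul, h1] at h2
    rw [h2]
    by_contra hne
    have := hsupp w' hne
    omega
  · -- elsewhere every summand of `E_{r s} c` vanishes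
    rw [wordRaise_apply]
    refine Finset.sum_eq_zero fun p hp => ?_
    simp only [Finset.mem_filter, Finset.mem_univ, true_and] at hp
    by_contra hne
    have h1 := hsupp _ hne
    have h2 := wordContent_update_self hp hrs.ne
    apply hw'
    rw [← h1, ← h2]
    push_cast
    ring

end Transvection

/-! ### The `𝔰𝔩_2` ladder: no highest-weight vectors of non-dominant weight -/

section Ladder

variable {k : Type*} [Field k] {N m : ℕ}

/-- `c` is supported on words with exactly `x` letters `a` and `y` letters `b` (integers `x, y`,
so that the bookkeeping along the ladder needs no side conditions; for `x < 0` or `y < 0` only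
`c = 0` qualifies). Auxiliary for `highestWeightSpace_wordRep_eq_bot_of_lt`. [folklore] -/
def IsRSSupported (a b : Fin N) (x y : ℤ) (c : Word N m → k) : Prop :=
  ∀ w, c w ≠ 0 → (wordContent w a : ℤ) = x ∧ (wordContent w b : ℤ) = y

/-- Symmetry of the support condition in the two letters. [folklore] -/
theorem IsRSSupported.symm {a b : Fin N} {x y : ℤ} {c : Word N m → k}
    (h : IsRSSupported a b x y c) : IsRSSupported b a y x c :=
  fun w hw => (h w hw).symm

/-- A vector supported on a negative number of letters vanishes. [folklore] -/
theorem IsRSSupported.eq_zero_of_neg {a b : Fin N} {x y : ℤ} {c : Word N m → k}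
    (h : IsRSSupported a b x y c) (hx : x < 0) : c = 0 := by
  funext w
  by_contra hw
  have := (h w hw).1
  omega

/-- `E_{a b}` moves the support: one more `a`, one fewer `b`. [folklore] -/
theorem IsRSSupported.raise {a b : Fin N} (hab : a ≠ b) {x y : ℤ} {c : Word N m → k}
    (h : IsRSSupported a b x y c) : IsRSSupported a b (x + 1) (y - 1) (wordRaise k a b c) := by
  classical
  intro w hw
  rw [wordRaise_apply] at hw
  obtain ⟨p, hp, hne⟩ := Finset.exists_ne_zero_of_sum_ne_zero hw
  simp only [Finset.mem_filter, Finset.mem_univ, true_and] at hp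
  obtain ⟨h1, h2⟩ := h _ hne
  have h3 := wordContent_update_self hp hab
  have h4 := wordContent_update_new hp hab
  constructor
  · rw [← h1, ← h3]
    push_cast
    ring
  · rw [← h2, h4]
    push_cast
    ring

/-- Iterating the lowering operator `E_{b a}` moves the support `j` steps down the ladder.
[folklore] -/
theorem IsRSSupported.iterate_lower {a b : Fin N} (hab : a ≠ b) {x y : ℤ}
    {c : Word N m → k} (h : IsRSSupported a b x y c) (j : ℕ) :
    IsRSSupported a b (x - j) (y + j) ((wordRaise k b a)^[j] c) := by
  induction j with
  | zero => simpa using h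
  | succ j ih =>
    rw [Function.iterate_succ_apply']
    have := (ih.symm.raise (Ne.symm hab)).symm
    convert this using 1 <;> push_cast <;> ring

/-- On vectors supported in a fixed content layer, `[E_{a b}, E_{b a}]` acts by the scalar
`x - y` (`H`-eigenvalue). Fulton–Harris §11.1, (11.1)–(11.3). [folklore] -/
theorem IsRSSupported.comm_eq_smul {a b : Fin N} (hab : a ≠ b) {x y : ℤ} {c : Word N m → k}
    (h : IsRSSupported a b x y c) :
    wordRaise k a b (wordRaise k b a c) - wordRaise k b a (wordRaise k a b c) =
      ((x - y : ℤ) : k) • c := by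
  funext w
  rw [Pi.sub_apply, wordRaise_comm_apply hab, Pi.smul_apply, smul_eq_mul]
  by_cases hw : c w = 0
  · rw [hw, mul_zero, mul_zero]
  · obtain ⟨h1, h2⟩ := h w hw
    rw [← h1, ← h2]
    push_cast
    ring

/-- **The `𝔰𝔩_2` ladder.** If `c` is killed by `E = E_{a b}` and supported in a content layer with
`H`-eigenvalue `λ = x - y`, then for `F = E_{b a}`:
`E F^{j+1} c = (j + 1)(λ - j) F^j c`. Fulton–Harris §11.1, (11.5). [folklore] -/
theorem wordRaise_iterate_succ {a b : Fin N} (hab : a ≠ b) {x y : ℤ} {c : Word N m → k}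
    (h : IsRSSupported a b x y c) (hE : wordRaise k a b c = 0) (j : ℕ) :
    wordRaise k a b ((wordRaise k b a)^[j + 1] c) =
      (((j + 1 : ℕ) : k) * ((x - y : ℤ) - j : k)) • (wordRaise k b a)^[j] c := by
  induction j with
  | zero =>
    have h1 := h.comm_eq_smul hab
    rw [hE, map_zero, sub_zero] at h1
    simp only [zero_add, Function.iterate_succ_apply', Function.iterate_zero_apply, h1]
    congr 1
    push_cast
    ring
  | succ j ih =>
    have hs := (h.iterate_lower hab (j + 1)).comm_eq_smul hab
    rw [sub_eq_iff_eq_add] at hs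
    rw [Function.iterate_succ_apply', hs, ih, map_smul,
      ← Function.iterate_succ_apply' (wordRaise k b a), ← add_smul]
    congr 1
    push_cast
    ring

/-- **Descent along the ladder.** With `λ = x - y < 0` (characteristic zero) all ladder
coefficients `(j+1)(λ - j)` are nonzero, so `F^n c = 0` forces `c = 0`.
Fulton–Harris §11.1 (the step after (11.7): `0 = X(Yᵐv) = m(n - m + 1) Yᵐ⁻¹v`). [folklore] -/
theorem eq_zero_of_iterate_wordRaise_eq_zero [CharZero k] {a b : Fin N} (hab : a ≠ b) {x y : ℤ}
    {c : Word N m → k} (h : IsRSSupported a b x y c) (hE : wordRaise k a b c = 0)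
    (hxy : x < y) (n : ℕ) (hn : (wordRaise k b a)^[n] c = 0) : c = 0 := by
  induction n with
  | zero => simpa using hn
  | succ n ih =>
    apply ih
    have h1 := wordRaise_iterate_succ hab h hE n
    rw [hn, map_zero] at h1
    refine (smul_eq_zero.1 h1.symm).resolve_left (mul_ne_zero ?_ ?_)
    · exact Nat.cast_ne_zero.2 (Nat.succ_ne_zero n)
    · have : ((x - y : ℤ) - n : k) = ((x - y - n : ℤ) : k) := by push_cast; ring
      rw [this, Int.cast_ne_zero]
      omega

/-- A vector killed by `E_{a b}` and supported in a content layer with `n_a < n_b` vanishes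
(characteristic zero): the ladder `F^j c` reaches `0` after `x + 1` steps (no words with a
negative number of letters `a`), then descend. Fulton–Harris §11.1, (11.5)–(11.7); Fulton,
*Young Tableaux*, §8.2 (Thm 2: highest weights are partitions). [folklore] -/
theorem IsRSSupported.eq_zero_of_wordRaise_eq_zero [CharZero k] {a b : Fin N} (hab : a ≠ b)
    {x y : ℤ} {c : Word N m → k} (h : IsRSSupported a b x y c) (hE : wordRaise k a b c = 0)
    (hxy : x < y) : c = 0 := by
  refine eq_zero_of_iterate_wordRaise_eq_zero hab h hE hxy (x.toNat + 1) ?_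
  exact (h.iterate_lower hab (x.toNat + 1)).eq_zero_of_neg (by omega)

/-- **No highest-weight vectors of non-dominant weight.** In characteristic zero, if
`ν r < ν s` for some `r < s` then `(k^N)^{⊗m}` (coordinate model) has no nonzero highest-weight
vectors of weight `ν`: such a vector is killed by `E_{r s}`
(`wordRaise_eq_zero_of_mem_highestWeightSpace`) and lives in the content layer `ν`, and the
`𝔰𝔩_2` ladder applies. Fulton, *Young Tableaux*, §8.2 (highest weights of polynomial
representations are partitions); Fulton–Harris Prop. 15.15 with §11.1. [folklore] -/
theorem highestWeightSpace_wordRep_eq_bot_of_lt [CharZero k] {ν : Weight (Fin N)} {r s : Fin N}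
    (hrs : r < s) (hν : ν r < ν s) : highestWeightSpace (wordRep k N m) ν = ⊥ := by
  rw [Submodule.eq_bot_iff]
  intro c hc
  have hsupp : IsRSSupported r s (ν r) (ν s) c := fun w hw =>
    ⟨by_contra fun hne => hw (apply_eq_zero_of_mem_highestWeightSpace k hc hne),
      by_contra fun hne => hw (apply_eq_zero_of_mem_highestWeightSpace k hc hne)⟩
  exact hsupp.eq_zero_of_wordRaise_eq_zero hrs.ne
    (wordRaise_eq_zero_of_mem_highestWeightSpace hrs hc) hν

end Ladder

/-! ### The weight of a Young diagram; the upper bound `dim HW ≤ f^λ` -/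

section UpperBound

open YoungDiagram

/-- The weight `(λ_1, …, λ_N)` of `GL_N` attached to a Young diagram: its row lengths (rows
`≥ N` are ignored; all uses carry the hypothesis that the diagram has at most `N` rows). For
`Y = μ.youngDiagram` this is `Weight.ofPartition N μ` (`ydWeight_youngDiagram`).
Fulton, *Young Tableaux*, §8.2. [folklore] -/
def ydWeight (N : ℕ) (Y : YoungDiagram) : Weight (Fin N) :=
  fun i => (Y.rowLen i : ℤ)

/-- Unfolding lemma for `ydWeight`. [folklore] -/
@[simp]
theorem ydWeight_apply (N : ℕ) (Y : YoungDiagram) (i : Fin N) :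
    ydWeight N Y i = (Y.rowLen i : ℤ) :=
  rfl

/-- Removing the corner box of row `r` subtracts `ε_r` from the weight. [folklore] -/
theorem ydWeight_removeAbove_corner {N : ℕ} {Y : YoungDiagram} {r : Fin N}
    (h : Y.rowLen (r + 1) < Y.rowLen r) :
    ydWeight N (Y.removeAbove (r, Y.rowLen r - 1)) = ydWeight N Y - Pi.single r 1 := by
  funext i
  rw [Pi.sub_apply, ydWeight_apply, ydWeight_apply]
  by_cases hi : i = r
  · subst hi
    rw [YoungDiagram.rowLen_removeAbove_corner_self h, Pi.single_eq_same]
    omega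
  · rw [YoungDiagram.rowLen_removeAbove_corner_of_ne h (fun h' => hi (Fin.ext h')),
      Pi.single_eq_of_ne hi, sub_zero]

/-- The row lengths of `μ.youngDiagram` are the (zero-padded) sorted parts of `μ`. [folklore] -/
theorem rowLen_youngDiagram {d : ℕ} (μ : Nat.Partition d) (i : ℕ) :
    μ.youngDiagram.rowLen i = μ.sortedParts.getD i 0 := by
  refine YoungDiagram.rowLen_eq_of_forall_mem_iff fun j => ?_
  rw [Nat.Partition.mem_youngDiagram_iff]
  by_cases hi : i < μ.sortedParts.length
  · rw [List.getD_eq_getElem _ _ hi]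
    exact ⟨fun ⟨_, h⟩ => h, fun h => ⟨hi, h⟩⟩
  · rw [List.getD_eq_default _ _ (not_lt.1 hi)]
    exact ⟨fun ⟨h, _⟩ => absurd h hi, fun h => absurd h (Nat.not_lt_zero _)⟩

/-- The weight of the Young diagram of `μ` is the weight `Weight.ofPartition N μ` of the
partition. Fulton, *Young Tableaux*, §8.2. [folklore] -/
theorem ydWeight_youngDiagram (N : ℕ) {d : ℕ} (μ : Nat.Partition d) :
    ydWeight N μ.youngDiagram = Weight.ofPartition N μ := by
  funext i
  rw [ydWeight_apply, rowLen_youngDiagram]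
  rfl

/-- The Young diagram of a partition with at most `N` parts has all its cells in rows `< N`.
[folklore] -/
theorem fst_lt_of_mem_youngDiagram {N d : ℕ} (μ : Nat.Partition d) (hμ : μ.parts.card ≤ N)
    {x : ℕ × ℕ} (hx : x ∈ μ.youngDiagram.cells) : x.1 < N := by
  obtain ⟨h, -⟩ := (Nat.Partition.mem_youngDiagram_iff μ x).1 ((YoungDiagram.mem_cells _).1 hx)
  rw [Nat.Partition.length_sortedParts] at h
  omega

variable {k : Type*} [Field k] [CharZero k] {N : ℕ}

/-- The summands of the Pieri inequality for the weight of a Young diagram `Y` (at most `N`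
rows, `|Y| = m + 1`): the term of row `r` vanishes unless row `r` ends in a corner, in which
case it is bounded by the number of standard fillings of `Y` minus that corner — given the
bound for diagrams with `m` cells. Rows `r` with `λ_r = 0` give a weight with a negative entry
(`highestWeightSpace_wordRep_eq_bot_of_neg`), rows with `λ_{r+1} = λ_r ≥ 1` a non-dominant
weight (`highestWeightSpace_wordRep_eq_bot_of_lt`). Fulton, *Young Tableaux*, §8.2–8.3.
[folklore] -/
theorem finrank_highestWeightSpace_sub_single_le {m : ℕ} {Y : YoungDiagram}
    (hY : Y.cells.card = m + 1) (hN : ∀ x ∈ Y.cells, x.1 < N)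
    (ih : ∀ Y' : YoungDiagram, Y'.cells.card = m → (∀ x ∈ Y'.cells, x.1 < N) →
      Module.finrank k (highestWeightSpace (wordRep k N m) (ydWeight N Y')) ≤
        Nat.card (StdFilling m Y'))
    (r : Fin N) :
    Module.finrank k (highestWeightSpace (wordRep k N m) (ydWeight N Y - Pi.single r 1)) ≤
      if Y.rowLen (r + 1) < Y.rowLen r then
        Nat.card (StdFilling m (Y.removeAbove (r, Y.rowLen r - 1))) else 0 := by
  by_cases hc : Y.rowLen (r + 1) < Y.rowLen r
  · -- corner row: induction hypothesis for `Y` minus the corner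
    rw [if_pos hc, ← ydWeight_removeAbove_corner hc]
    refine ih _ ?_ fun x hx => hN x ?_
    · rw [YoungDiagram.card_removeAbove_corner hc, hY, Nat.add_sub_cancel]
    · exact (YoungDiagram.mem_cells _).2
        (YoungDiagram.mem_of_mem_removeAbove ((YoungDiagram.mem_cells _).1 hx))
  · rw [if_neg hc, Nat.le_zero]
    have hbot : highestWeightSpace (wordRep k N m) (ydWeight N Y - Pi.single r 1) = ⊥ := by
      by_cases h0 : Y.rowLen r = 0
      · -- empty row: negative entry
        refine highestWeightSpace_wordRep_eq_bot_of_neg k (i := r) ?_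
        rw [Pi.sub_apply, ydWeight_apply, Pi.single_eq_same, h0]
        norm_num
      · -- `λ_{r+1} = λ_r ≥ 1`: the row `r + 1` is a row of `Y`, and the weight is not dominant
        have h1 : ((r : ℕ) + 1, 0) ∈ Y.cells :=
          (YoungDiagram.mem_cells _).2 (YoungDiagram.mem_iff_lt_rowLen.2 (by omega))
        have hs : (r : ℕ) + 1 < N := hN _ h1
        set s : Fin N := ⟨(r : ℕ) + 1, hs⟩ with hs_def
        have hrs : r < s := by
          rw [Fin.lt_def, hs_def]
          exact Nat.lt_succ_self _
        have hne : s ≠ r := ne_of_gt hrs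
        refine highestWeightSpace_wordRep_eq_bot_of_lt (k := k) hrs ?_
        rw [Pi.sub_apply, Pi.sub_apply, ydWeight_apply, ydWeight_apply, Pi.single_eq_same,
          Pi.single_eq_of_ne hne, sub_zero, hs_def]
        simp only
        omega
    rw [hbot, finrank_bot]

/-- **Upper bound: `dim HW_λ((k^N)^{⊗|λ|}) ≤ f^λ`.** For a Young diagram `Y` with at most `N`
rows and `m` cells, the highest-weight vectors of weight `λ = ydWeight N Y` in `(k^N)^{⊗m}`
span a space of dimension at most the number of standard Young tableaux of shape `Y`
(characteristic zero). By induction on `m`: the Pieri inequality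
(`finrank_highestWeightSpace_succ_le`) bounds the dimension by the sum over the rows `r` of the
dimensions for `λ - ε_r`, only corner rows survive (`finrank_highestWeightSpace_sub_single_le`),
and the branching rule `f^λ = ∑_{corners} f^{λ⁻}` (`StdFilling.card_stdFilling_succ`)
reassembles the bound. This is the multiplicity form of `E^{⊗n} ≅ ⊕ (E^λ)^{⊕ f^λ}`, upper half.
Fulton, *Young Tableaux*, §8.3 Cor. 1 (p. 119) with §8.2 Lemma 4; Fulton–Harris Thm 6.3 (2)
with the Pieri formula (6.8) (`m = 1`) / Ex. 6.12. [folklore] -/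
theorem finrank_highestWeightSpace_le_card_stdFilling (m : ℕ) :
    ∀ (Y : YoungDiagram), Y.cells.card = m → (∀ x ∈ Y.cells, x.1 < N) →
      Module.finrank k (highestWeightSpace (wordRep k N m) (ydWeight N Y)) ≤
        Nat.card (StdFilling m Y) := by
  induction m with
  | zero =>
    intro Y _ _
    rw [StdFilling.card_zero]
    refine (Submodule.finrank_le _).trans (le_of_eq ?_)
    rw [Module.finrank_fintype_fun_eq_card, Fintype.card_fun, Fintype.card_fin, Fintype.card_fin,
      pow_zero]
  | succ m ih =>
    intro Y hY hN
    classical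
    calc Module.finrank k (highestWeightSpace (wordRep k N (m + 1)) (ydWeight N Y))
        ≤ ∑ r : Fin N, Module.finrank k
            (highestWeightSpace (wordRep k N m) (ydWeight N Y - Pi.single r 1)) :=
          finrank_highestWeightSpace_succ_le _
      _ ≤ ∑ r : Fin N, if Y.rowLen (r + 1) < Y.rowLen r then
            Nat.card (StdFilling m (Y.removeAbove (r, Y.rowLen r - 1))) else 0 :=
          Finset.sum_le_sum fun r _ => finrank_highestWeightSpace_sub_single_le hY hN ih r
      _ = ∑ r ∈ Finset.univ.filter (fun r : Fin N => Y.rowLen (r + 1) < Y.rowLen r),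
            Nat.card (StdFilling m (Y.removeAbove (r, Y.rowLen r - 1))) := by
          rw [Finset.sum_filter]
      _ = ∑ c ∈ (Finset.univ.filter (fun r : Fin N => Y.rowLen (r + 1) < Y.rowLen r)).image
            (fun r : Fin N => ((r : ℕ), Y.rowLen r - 1)),
            Nat.card (StdFilling m (Y.removeAbove c)) := by
          rw [Finset.sum_image]
          intro r₁ _ r₂ _ h
          exact Fin.ext (Prod.ext_iff.1 h).1
      _ ≤ ∑ c ∈ Y.cells, Nat.card (StdFilling m (Y.removeAbove c)) := by
          apply Finset.sum_le_sum_of_subset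
          intro c hc
          simp only [Finset.mem_image, Finset.mem_filter, Finset.mem_univ, true_and] at hc
          obtain ⟨r, hr, rfl⟩ := hc
          exact (YoungDiagram.mem_cells _).2 (YoungDiagram.mem_iff_lt_rowLen.2 (by omega))
      _ = Nat.card (StdFilling (m + 1) Y) := (StdFilling.card_stdFilling_succ m Y).symm

end UpperBound

/-! ### Polytabloids: the lower bound `f^λ ≤ dim HW` -/

section Polytabloid

open YoungDiagram

variable {k : Type*} [Field k] {N d : ℕ} {Y : YoungDiagram}

namespace StdFilling

/-- The *row word* of a filling `T` of a Young diagram with at most `N` rows: position (entry)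
`p` carries the letter "row of `p` in `T`". The basis vector `e_{w_T}` of `E^{⊗d}` is Fulton's
`e_T` for the tableau `T` (Fulton, *Young Tableaux*, §8.1: `e_T = ⊗_p e_{row of p}`); as a
tabloid it is James' `{t}` (LNM 682, 3.9). [folklore] -/
def rowWord (hN : ∀ x ∈ Y.cells, x.1 < N) (T : StdFilling d Y) : Word N d :=
  fun p => ⟨(T.1 p).1, hN _ ((YoungDiagram.mem_cells _).2 (T.mem p))⟩

/-- Unfolding lemma for `rowWord`. [folklore] -/
@[simp]
theorem rowWord_val (hN : ∀ x ∈ Y.cells, x.1 < N) (T : StdFilling d Y) (p : Fin d) :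
    ((T.rowWord hN p : Fin N) : ℕ) = (T.1 p).1 :=
  rfl

/-- The content of the row word of a standard Young tableau of shape `Y` is the weight of `Y`
(row `i` has `λ_i` entries). Fulton, *Young Tableaux*, §8.1–8.2 (`e_T` is a weight vector of
weight `λ`). [folklore] -/
theorem wordContent_rowWord (hN : ∀ x ∈ Y.cells, x.1 < N) (T : StdFilling d Y)
    (hd : Y.cells.card = d) (i : Fin N) : wordContent (T.rowWord hN) i = Y.rowLen i := by
  classical
  rw [wordContent, YoungDiagram.rowLen_eq_card]
  refine Finset.card_bij (fun p _ => T.1 p) ?_ ?_ ?_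
  · intro p hp
    simp only [Finset.mem_filter, Finset.mem_univ, true_and] at hp
    exact YoungDiagram.mem_row_iff.2 ⟨T.mem p, by rw [← hp]; rfl⟩
  · intro p₁ _ p₂ _ h
    exact T.injective h
  · intro c hc
    rw [YoungDiagram.mem_row_iff] at hc
    obtain ⟨p, hp⟩ := T.exists_eq hd hc.1
    refine ⟨p, ?_, hp⟩
    simp only [Finset.mem_filter, Finset.mem_univ, true_and]
    exact Fin.ext (by rw [rowWord_val, hp]; exact hc.2)

/-- The *column stabiliser* `C_T ⊆ S_d` of a filling: permutations of the entries preserving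
the column of every entry. Fulton, *Young Tableaux*, §7.1 (`C(T)`); James, LNM 682, 3.8.
[folklore] -/
def colStab (T : StdFilling d Y) : Finset (Equiv.Perm (Fin d)) :=
  Finset.univ.filter fun σ => ∀ p, (T.1 (σ p)).2 = (T.1 p).2

/-- Membership in the column stabiliser (unfolding lemma). [folklore] -/
theorem mem_colStab {T : StdFilling d Y} {σ : Equiv.Perm (Fin d)} :
    σ ∈ T.colStab ↔ ∀ p, (T.1 (σ p)).2 = (T.1 p).2 := by
  simp [colStab]

/-- `1 ∈ C_T`. [folklore] -/
theorem one_mem_colStab (T : StdFilling d Y) : (1 : Equiv.Perm (Fin d)) ∈ T.colStab :=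
  mem_colStab.2 fun _ => rfl

/-- `C_T` is closed under multiplication. [folklore] -/
theorem mul_mem_colStab {T : StdFilling d Y} {σ τ : Equiv.Perm (Fin d)} (hσ : σ ∈ T.colStab)
    (hτ : τ ∈ T.colStab) : σ * τ ∈ T.colStab :=
  mem_colStab.2 fun p => by rw [Equiv.Perm.mul_apply, mem_colStab.1 hσ, mem_colStab.1 hτ]

/-- `C_T` is closed under inverses. [folklore] -/
theorem inv_mem_colStab {T : StdFilling d Y} {σ : Equiv.Perm (Fin d)} (hσ : σ ∈ T.colStab) :
    σ⁻¹ ∈ T.colStab :=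
  mem_colStab.2 fun p => by
    have := mem_colStab.1 hσ (σ⁻¹ p)
    simp only [Equiv.Perm.coe_inv, Equiv.apply_symm_apply] at this
    exact this.symm

/-- The transposition of two entries in the same column lies in `C_T`. [folklore] -/
theorem swap_mem_colStab {T : StdFilling d Y} {p q : Fin d} (h : (T.1 p).2 = (T.1 q).2) :
    Equiv.swap p q ∈ T.colStab := by
  classical
  refine mem_colStab.2 fun x => ?_
  rcases eq_or_ne x p with rfl | hxp
  · rw [Equiv.swap_apply_left]
    exact h.symm
  rcases eq_or_ne x q with rfl | hxq
  · rw [Equiv.swap_apply_right]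
    exact h
  · rw [Equiv.swap_apply_of_ne_of_ne hxp hxq]

variable (k) in
/-- The *column antisymmetriser* `κ_T = ∑_{σ ∈ C_T} sgn(σ) σ` acting on the coordinate model of
`E^{⊗d}` through the position action `wordPerm`. Fulton, *Young Tableaux*, §7.2 (`b_T`), §8.1;
James, LNM 682, 4.3 (`κ_t`). [folklore] -/
def colAntisym (T : StdFilling d Y) : (Word N d → k) →ₗ[k] (Word N d → k) :=
  ∑ σ ∈ T.colStab, ((Equiv.Perm.sign σ : ℤ) : k) • wordPerm k σ

/-- Unfolding lemma for `colAntisym`. [folklore] -/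
theorem colAntisym_apply (T : StdFilling d Y) (c : Word N d → k) :
    T.colAntisym k c = ∑ σ ∈ T.colStab, ((Equiv.Perm.sign σ : ℤ) : k) • wordPerm k σ c := by
  simp [colAntisym, LinearMap.sum_apply, LinearMap.smul_apply]

/-- The column antisymmetriser commutes with the action of `GL_N` (it is built from the
commuting `S_d`-action). Fulton, *Young Tableaux*, §8.1; Fulton–Harris Lemma 6.22. [folklore] -/
theorem colAntisym_wordRep (T : StdFilling d Y) (g : GL (Fin N) k) (c : Word N d → k) :
    T.colAntisym k (wordRep k N d g c) = wordRep k N d g (T.colAntisym k c) := by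
  rw [colAntisym_apply, colAntisym_apply, map_sum]
  refine Finset.sum_congr rfl fun σ _ => ?_
  rw [map_smul, wordPerm_wordRep]

/-- **`κ_T` kills basis vectors with a repeated letter in a column of `T`**: if `w p = w q` for
two entries `p ≠ q` in the same column then `κ_T e_w = 0`, since the transposition `(p q) ∈ C_T`
fixes `e_w` and has sign `-1` (characteristic `≠ 2`). Fulton, *Young Tableaux*, §8.1 Lemma 1 (i)
and §7.2 Lemma 2 (`b_T · t = -b_T`); James, LNM 682, proof of 4.6. [folklore] -/
theorem colAntisym_single_eq_zero [CharZero k] (T : StdFilling d Y) {w : Word N d} {p q : Fin d}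
    (hpq : p ≠ q) (hcol : (T.1 p).2 = (T.1 q).2) (hw : w p = w q) :
    T.colAntisym k (Pi.single w 1) = 0 := by
  classical
  have hτ : Equiv.swap p q ∈ T.colStab := swap_mem_colStab hcol
  have hwτ : ∀ x, w (Equiv.swap p q x) = w x := fun x => Equiv.apply_swap_eq_self hw x
  set S := T.colAntisym k (Pi.single w 1) with hS_def
  have hneg : S = -S := by
    rw [hS_def, colAntisym_apply]
    simp_rw [wordPerm_single]
    rw [← Finset.sum_neg_distrib]
    refine Finset.sum_bij' (fun σ _ => σ * Equiv.swap p q) (fun σ _ => σ * Equiv.swap p q)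
      (fun σ hσ => mul_mem_colStab hσ hτ) (fun σ hσ => mul_mem_colStab hσ hτ)
      (fun σ _ => by rw [mul_assoc, Equiv.swap_mul_self, mul_one])
      (fun σ _ => by rw [mul_assoc, Equiv.swap_mul_self, mul_one]) ?_
    intro σ _
    have h1 : (w ∘ ⇑(σ * Equiv.swap p q)⁻¹ : Word N d) = w ∘ ⇑σ⁻¹ := by
      funext x
      change w ((σ * Equiv.swap p q)⁻¹ x) = w (σ⁻¹ x)
      rw [mul_inv_rev, Equiv.Perm.mul_apply, Equiv.swap_inv]
      exact hwτ _
    rw [h1, Equiv.Perm.sign_mul, Equiv.Perm.sign_swap hpq]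
    simp
  have h2 : (2 : k) • S = 0 := by
    rw [two_smul]
    nth_rewrite 2 [hneg]
    rw [add_neg_cancel]
  exact (smul_eq_zero.1 h2).resolve_left two_ne_zero

/-- For upper triangular `g`, `g · e_u` involves only basis vectors `e_{w'}` with `w' ≤ u`
letterwise: `(g · e_u)(w') = ∏_p g_{w' p, u p}`. Fulton, *Young Tableaux*, §8.2 (Exercise 3 and
proof of Lemma 4: for `T = U(λ)` and `g ∈ B` only `e_T` itself occurs in `g · e_T`).
[folklore] -/
theorem le_of_wordRep_single_apply_ne_zero {g : GL (Fin N) k} (hg : IsUpperTriangular g)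
    {u w' : Word N d} (h : wordRep k N d g (Pi.single u 1) w' ≠ 0) (p : Fin d) : w' p ≤ u p := by
  rw [wordRep_single] at h
  by_contra hlt
  exact Finset.prod_ne_zero_iff.1 h p (Finset.mem_univ p) (hg.apply_eq_zero (_root_.not_le.1 hlt))

/-- The diagonal coefficient: `(g · e_u)(u) = ∏_p g_{u p, u p} = ∏_i g_{i i}^{n_i(u)}`, the weight
character of the content of `u`. Fulton, *Young Tableaux*, §8.2 (Exercise 3). [folklore] -/
theorem wordRep_single_apply_self (g : GL (Fin N) k) (u : Word N d) :
    wordRep k N d g (Pi.single u 1) u = weightChar (fun i => (wordContent u i : ℤ)) g := by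
  rw [wordRep_single, prod_eq_prod_pow_wordContent (fun i => (g : Matrix (Fin N) (Fin N) k) i i) u,
    weightChar]
  simp only [zpow_natCast]

/-- **Pigeonhole in the columns.** If a word `w'` is letterwise `≤` the row word of a standard
Young tableau `T` (of full shape) and different from it, then two distinct entries in one column
of `T` carry the same letter: at a bad entry `p` of minimal row, the cell `(w' p, col p)` above
`T p` carries an entry `p'` which is good, so `w' p' = w' p`. Fulton, *Young Tableaux*, §8.2
(proof of Lemma 4) / §7.1 (Lemma 1); James, LNM 682, 3.7 and proof of 4.6. [folklore] -/
theorem exists_eq_of_le_rowWord (hN : ∀ x ∈ Y.cells, x.1 < N) (T : StdFilling d Y)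
    (hd : Y.cells.card = d) {w' : Word N d} (hle : ∀ p, (w' p : ℕ) ≤ (T.1 p).1)
    (hne : w' ≠ T.rowWord hN) : ∃ p q, p ≠ q ∧ (T.1 p).2 = (T.1 q).2 ∧ w' p = w' q := by
  classical
  obtain ⟨p₁, hp₁⟩ := Function.ne_iff.1 hne
  set bad := Finset.univ.filter (fun p => (w' p : ℕ) ≠ (T.1 p).1) with hbad_def
  have hp₁' : p₁ ∈ bad := by
    simp only [hbad_def, Finset.mem_filter, Finset.mem_univ, true_and]
    exact fun h => hp₁ (Fin.ext h)
  obtain ⟨p, hp, hmin⟩ := Finset.exists_min_image bad (fun p => (T.1 p).1) ⟨p₁, hp₁'⟩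
  simp only [hbad_def, Finset.mem_filter, Finset.mem_univ, true_and] at hp
  have hlt : (w' p : ℕ) < (T.1 p).1 := lt_of_le_of_ne (hle p) hp
  have hcell : ((w' p : ℕ), (T.1 p).2) ∈ Y := Y.up_left_mem hlt.le le_rfl (T.mem p)
  obtain ⟨p', hp'⟩ := T.exists_eq hd hcell
  have hrow : (T.1 p').1 = (w' p : ℕ) := by rw [hp']
  have hgood : (w' p' : ℕ) = (T.1 p').1 := by
    by_contra h
    have := hmin p' (by simp [hbad_def, h])
    omega
  refine ⟨p', p, ?_, by rw [hp'], Fin.ext (by rw [hgood, hrow])⟩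
  rintro rfl
  omega

variable (k) in
/-- The **polytabloid** `e_T := κ_T e_{w_T} = ∑_{σ ∈ C_T} sgn(σ) e_{w_T ∘ σ⁻¹}` of a filling
`T`, in the coordinate model of `E^{⊗d}` (Fulton's `v_T = e_T · b_T`, the image of `e_T` in
the Weyl module; James' polytabloid `e_t = κ_t {t}` under `{t} ↦ e_{w_T}`).
Fulton, *Young Tableaux*, §8.1 (proof of Thm 1); James, LNM 682, 4.3. [folklore] -/
def polytabloid (hN : ∀ x ∈ Y.cells, x.1 < N) (T : StdFilling d Y) : Word N d → k :=
  T.colAntisym k (Pi.single (T.rowWord hN) 1)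

/-- **Polytabloids are highest-weight vectors of weight `λ`.** For a standard Young tableau `T`
of shape `Y` (`≤ N` rows, `|Y| = d`) and upper triangular `g`,
`g · e_T = κ_T (g · e_{w_T}) = κ_T (χ_λ(g) e_{w_T} + ∑_{w' < w_T} a_{w'} e_{w'}) = χ_λ(g) e_T`,
the lower terms dying by the column pigeonhole (`exists_eq_of_le_rowWord`,
`colAntisym_single_eq_zero`). Fulton, *Young Tableaux*, §8.2 Lemma 4 and its proof (`e_{U(λ)}`
is the highest-weight vector of `E^λ`) with §8.1 Lemma 1 (i); James, LNM 682, 4.3–4.6.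
[folklore] -/
theorem polytabloid_mem [CharZero k] (hN : ∀ x ∈ Y.cells, x.1 < N) (T : StdFilling d Y)
    (hd : Y.cells.card = d) :
    T.polytabloid k hN ∈ highestWeightSpace (wordRep k N d) (ydWeight N Y) := by
  classical
  intro g hg
  rw [polytabloid, ← colAntisym_wordRep]
  set u := T.rowWord hN with hu_def
  set f := wordRep k N d g (Pi.single u 1) with hf_def
  have hwt : (fun i => (wordContent u i : ℤ)) = ydWeight N Y :=
    funext fun i => by rw [ydWeight_apply, hu_def, wordContent_rowWord hN T hd i]
  rw [pi_eq_sum_univ' f, map_sum, Finset.sum_eq_single u]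
  · rw [map_smul, hf_def, wordRep_single_apply_self, hwt]
  · intro w' _ hne
    rw [map_smul]
    by_cases hle : ∀ p, w' p ≤ u p
    · obtain ⟨p, q, hpq, hcol, hw⟩ :=
        T.exists_eq_of_le_rowWord hN hd (fun p => Fin.le_def.1 (hle p)) hne
      rw [colAntisym_single_eq_zero T hpq hcol hw, smul_zero]
    · obtain ⟨p, hp⟩ : ∃ p, ¬ w' p ≤ u p := not_forall.1 hle
      have : f w' = 0 := by
        by_contra h
        exact hp (le_of_wordRep_single_apply_ne_zero hg h p)
      rw [this, zero_smul]
  · intro h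
    exact absurd (Finset.mem_univ u) h

/-- The coefficients of a polytabloid: `e_T(w) = ∑_{σ ∈ C_T, w = w_T ∘ σ⁻¹} sgn(σ)`.
[folklore] -/
theorem polytabloid_apply (hN : ∀ x ∈ Y.cells, x.1 < N) (T : StdFilling d Y) (w : Word N d) :
    T.polytabloid k hN w =
      ∑ σ ∈ T.colStab, if w = T.rowWord hN ∘ ⇑σ⁻¹ then ((Equiv.Perm.sign σ : ℤ) : k) else 0 := by
  rw [polytabloid, colAntisym_apply, Finset.sum_apply]
  refine Finset.sum_congr rfl fun σ _ => ?_
  rw [wordPerm_single, Pi.smul_apply, smul_eq_mul, Pi.single_apply]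
  split_ifs <;> simp

/-- The support of `e_T` consists of the words `w_T ∘ σ`, `σ ∈ C_T`. James, LNM 682, 4.3.
[folklore] -/
theorem exists_of_polytabloid_apply_ne_zero (hN : ∀ x ∈ Y.cells, x.1 < N) (T : StdFilling d Y)
    {w : Word N d} (h : T.polytabloid k hN w ≠ 0) : ∃ σ ∈ T.colStab, w = T.rowWord hN ∘ ⇑σ := by
  rw [polytabloid_apply] at h
  obtain ⟨σ, hσ, hne⟩ := Finset.exists_ne_zero_of_sum_ne_zero h
  refine ⟨σ⁻¹, inv_mem_colStab hσ, ?_⟩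
  by_contra hw
  exact hne (if_neg hw)

/-- An element of the column stabiliser fixing the row word is trivial (a filling is injective
on cells); cf. James, LNM 682, 4.3 (the tabloids involved in `e_t` have coefficient `±1`).
[folklore] -/
theorem eq_one_of_rowWord_comp_eq (hN : ∀ x ∈ Y.cells, x.1 < N) (T : StdFilling d Y)
    {σ : Equiv.Perm (Fin d)} (hσ : σ ∈ T.colStab) (h : T.rowWord hN ∘ ⇑σ = T.rowWord hN) :
    σ = 1 := by
  ext p : 1
  have hrow : (T.1 (σ p)).1 = (T.1 p).1 := congrArg Fin.val (congrFun h p)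
  exact T.injective (Prod.ext hrow (mem_colStab.1 hσ p))

/-- The polytabloid has coefficient `1` at its own row word: `e_T(w_T) = 1`.
James, LNM 682, 4.3; Fulton, *Young Tableaux*, §7.2, proof of Prop. 2 (`{T}` has coefficient `1`
in `v_T`). [folklore] -/
theorem polytabloid_apply_rowWord (hN : ∀ x ∈ Y.cells, x.1 < N) (T : StdFilling d Y) :
    T.polytabloid k hN (T.rowWord hN) = 1 := by
  rw [polytabloid_apply, Finset.sum_eq_single_of_mem 1 T.one_mem_colStab]
  · simp
  · intro σ hσ hne
    rw [if_neg]
    intro h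
    apply hne
    rw [← inv_eq_one]
    exact T.eq_one_of_rowWord_comp_eq hN (inv_mem_colStab hσ) h.symm

/-- **The row word is the last word of its polytabloid** (James, LNM 682, 8.2–8.3; Fulton,
*Young Tableaux*, §7.2, proof of Prop. 2: `q · T < T`; for standard `T`): for `σ ∈ C_T`,
`σ ≠ 1`, the word `w_T ∘ σ` is smaller than `w_T` in the colexicographic order read from the
last position — at the largest entry `q` moved by `σ`, the entry `σ q < q` lies higher in the
same column, so its row is smaller. [folklore] -/
theorem toColex_rowWord_comp_lt (hN : ∀ x ∈ Y.cells, x.1 < N) (T : StdFilling d Y)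
    {σ : Equiv.Perm (Fin d)} (hσ : σ ∈ T.colStab) (h1 : σ ≠ 1) :
    toColex (T.rowWord hN ∘ ⇑σ) < toColex (T.rowWord hN) := by
  classical
  set M := Finset.univ.filter (fun p => σ p ≠ p) with hM_def
  have hMne : M.Nonempty := by
    obtain ⟨p, hp⟩ : ∃ p, σ p ≠ p := by
      by_contra hall
      exact h1 (Equiv.ext fun x => (not_not.1 (not_exists.1 hall x)).trans
        (Equiv.Perm.one_apply x).symm)
    exact ⟨p, by simp [hM_def, hp]⟩
  set q := M.max' hMne with hq_def
  have hqM : q ∈ M := M.max'_mem hMne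
  have hq : σ q ≠ q := by simpa [hM_def] using hqM
  have hσqM : σ q ∈ M := by
    simp only [hM_def, Finset.mem_filter, Finset.mem_univ, true_and]
    exact fun h => hq (σ.injective h)
  have hσq_lt : σ q < q := lt_of_le_of_ne (M.le_max' _ hσqM) hq
  have hrow : (T.1 (σ q)).1 < (T.1 q).1 := T.row_lt_row_of_lt hσq_lt (mem_colStab.1 hσ q)
  refine ⟨q, fun j hj => ?_, ?_⟩
  · have hfix : σ j = j := by
      by_contra hne
      have hmem : j ∈ M := by simp [hM_def, hne]
      exact absurd (M.le_max' _ hmem) (_root_.not_le.2 hj)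
    change T.rowWord hN (σ j) = T.rowWord hN j
    rw [hfix]
  · change T.rowWord hN (σ q) < T.rowWord hN q
    exact Fin.lt_def.2 hrow

/-- **The polytabloids of the standard Young tableaux are linearly independent** (any field):
in a vanishing combination, the tableau `T₀` whose row word is colex-largest among those with
nonzero coefficient is the only one whose polytabloid does not vanish at `w_{T₀}`
(`toColex_rowWord_comp_lt`, and a standard tableau is determined by its row word,
`ext_of_row_eq`). Fulton, *Young Tableaux*, §7.2, proof of Prop. 2 / §8.1 Thm 1 (the `e_T`,
`T` standard, are independent); James, LNM 682, 8.2–8.4. [folklore] -/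
theorem linearIndependent_polytabloid (hN : ∀ x ∈ Y.cells, x.1 < N) (hd : Y.cells.card = d) :
    LinearIndependent k (fun T : StdFilling d Y => T.polytabloid k hN) := by
  classical
  rw [linearIndependent_iff']
  intro s g hsum
  by_contra hcon
  obtain ⟨T₁, hT₁s, hT₁⟩ : ∃ T ∈ s, g T ≠ 0 := by simpa using hcon
  set s' := s.filter (fun T => g T ≠ 0) with hs'_def
  obtain ⟨T₀, hT₀, hmax⟩ := Finset.exists_max_image s' (fun T => toColex (T.rowWord hN))
    ⟨T₁, by simp [hs'_def, hT₁s, hT₁]⟩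
  simp only [hs'_def, Finset.mem_filter] at hT₀
  have key := congrFun hsum (T₀.rowWord hN)
  rw [Finset.sum_apply, Pi.zero_apply, Finset.sum_eq_single_of_mem T₀ hT₀.1] at key
  · rw [Pi.smul_apply, polytabloid_apply_rowWord, smul_eq_mul, mul_one] at key
    exact hT₀.2 key
  · intro T hTs hne
    rw [Pi.smul_apply, smul_eq_mul]
    by_cases hg : g T = 0
    · rw [hg, zero_mul]
    · refine mul_eq_zero.2 (Or.inr ?_)
      by_contra hne0
      obtain ⟨σ, hσ, hw⟩ := T.exists_of_polytabloid_apply_ne_zero hN hne0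
      by_cases hσ1 : σ = 1
      · subst hσ1
        apply hne
        refine StdFilling.ext_of_row_eq hd fun p => ?_
        have := congrArg Fin.val (congrFun hw p)
        simpa using this.symm
      · have hlt := T.toColex_rowWord_comp_lt hN hσ hσ1
        rw [← hw] at hlt
        have hle := hmax T (by simp [hs'_def, hTs, hg])
        exact absurd (lt_of_le_of_lt hle hlt) (lt_irrefl _)

/-- **Lower bound: `f^λ ≤ dim HW_λ((k^N)^{⊗|λ|})`** (characteristic zero, `Y` with at most `N`
rows and `d` cells): the polytabloids of the standard Young tableaux of shape `Y` are linearly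
independent highest-weight vectors of weight `λ`. Fulton, *Young Tableaux*, §8.1 Thm 1 with
§8.2 Lemma 4; James, LNM 682, 8.4–8.5. [folklore] -/
theorem card_stdFilling_le_finrank [CharZero k] (hN : ∀ x ∈ Y.cells, x.1 < N)
    (hd : Y.cells.card = d) :
    Nat.card (StdFilling d Y) ≤
      Module.finrank k (highestWeightSpace (wordRep k N d) (ydWeight N Y)) := by
  classical
  let v : StdFilling d Y → highestWeightSpace (wordRep k N d) (ydWeight N Y) :=
    fun T => ⟨T.polytabloid k hN, T.polytabloid_mem hN hd⟩
  have hv : LinearIndependent k v :=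
    LinearIndependent.of_comp (Submodule.subtype _) (linearIndependent_polytabloid hN hd)
  rw [Nat.card_eq_fintype_card]
  exact hv.fintype_card_le_finrank

end StdFilling

end Polytabloid

/-! ### Assembly: Schur–Weyl duality, multiplicity form -/

section SchurWeyl

variable (k : Type*) [Field k] {d : ℕ}

/-- **Schur–Weyl duality, multiplicity form** (discharge of the named fact
`hwMultiplicity_glTensorRep`): for a field `k` of characteristic zero, `N ∈ ℕ` and a partition
`μ ⊢ d` with at most `N` parts, the multiplicity of the highest weight `μ` in `(k^N)^{⊗d}` is
the number `f^μ` of standard Young tableaux of shape `μ`. Proof: pass to the coordinate model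
(`hwMultiplicity_glTensorRep_eq_wordRep`); the upper bound is
`finrank_highestWeightSpace_le_card_stdFilling` (Pieri induction + branching rule), the lower
bound `StdFilling.card_stdFilling_le_finrank` (polytabloids). This is the statement
`E^{⊗n} ≅ ⊕_λ (E^λ)^{⊕ f^λ}` of Fulton, *Young Tableaux*, §8.3 Cor. 1 (p. 119) — the fact's
docstring cites it as "§8.2 Corollary" — combined with §8.2 Lemma 4 / Thm 2 (each `E^λ` has a
one-dimensional space of highest-weight vectors, of weight `λ`); equivalently Fulton–Harris
Thm 6.3 (2) (`V^{⊗d} ≅ ⊕ S_λV^{⊕ m_λ}`). The proof given here is elementary and self-contained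
(no Specht modules, semisimplicity or RSK).
[cite: FultonYoungTableaux1997, §8.3 Cor. 1 (p. 119) with §8.2 Lemma 4 and Thm 2]
[cite: FultonHarrisGTM129, Thm 6.3 (2)] -/
theorem hwMultiplicity_glTensorRep_holds : hwMultiplicity_glTensorRep k (d := d) := by
  intro _ N μ hμ
  rw [hwMultiplicity_glTensorRep_eq_wordRep, hwMultiplicity, ← ydWeight_youngDiagram,
    numStandardTableaux_eq_card_stdFilling]
  have hN : ∀ x ∈ μ.youngDiagram.cells, x.1 < N := fun x hx => fst_lt_of_mem_youngDiagram μ hμ hx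
  exact le_antisymm
    (finrank_highestWeightSpace_le_card_stdFilling d _ μ.card_cells_youngDiagram hN)
    (StdFilling.card_stdFilling_le_finrank hN μ.card_cells_youngDiagram)

end SchurWeyl

end Literature.NumberTheory.DiophantineGeometry
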